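import Literature.NumberTheory.DiophantineGeometry.TateAlgorithmThreeExitValuesProofs
import Literature.NumberTheory.DiophantineGeometry.TateAlgorithmThreeExitValuesStarProofs
import Literature.NumberTheory.DiophantineGeometry.TateAlgorithmThreeExitValuesLastProofs
import Literature.NumberTheory.DiophantineGeometry.TateAlgorithmPerfectField
import HarnessLib

/-!
# Tate's algorithm at `p = 3`: the row datum of a minimal equation (Papadopoulos's table)

`Proofs` file (theorems only; no definition, no named fact) in topic
`NumberTheory/DiophantineGeometry`, fourth file of the kernel discharge of
`WeierstrassCurve.conductorExponent_eq_tableConductorExponentThree` (cell `b2b-bsdres`, team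
n1011, ROW T-PAP3).  Over a discrete valuation ring `R` with perfect residue field in which `2`
is a unit and `3` a uniformiser (e.g. `ℤ₃`), Silverman's algorithm *ATAEC* IV.9.4 — the tree's
literal implementation `WeierstrassCurve.kodairaSymbolOfMinimal` — is walked branch by branch on
a minimal Weierstrass equation (`Δ ≠ 0`, Step 11 excluded), exactly as in
`TateAlgorithm.addVal_Δ_toNat_le_numComponents_add_four` (`ConductorExponentLeFiveProofs`), and
at each exit the exact data of `TateAlgorithmThreeExitValues{,Star,NineTen}Proofs` are recorded:
the Kodaira symbol together with `(ord c₄, ord c₆, ord Δ)` (exact values, or the divisibilities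
printed as "`≥`") and, on the four rows of Rizzo's Table II carrying a special condition
(`(≥2,3,3)` II / III, `(≥4,6,9)` IV* / III*), the intrinsic residue datum (`b₂/3^e`, `b₆/3^{e'}`
units or not) behind it.  The result `rowDatum_of_minimal` is the 24-row table of
I. Papadopoulos, J. Number Theory 44 (1993), Table III (`p = 3`) / O. G. Rizzo, Compositio
Math. 136 (2003), Table II, columns Kod and `(v(c₄), v(c₆), v(Δ))`, as a kernel theorem; Ogg's
value `ord Δ + 1 − m` on each row is then the printed `v(N)`.

## References

* J. H. Silverman, *Advanced Topics in the Arithmetic of Elliptic Curves*, GTM 151 (1994), IV.9.4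
  and Table 4.1. [Silverman1994]
* I. Papadopoulos, J. Number Theory 44 (1993) 119–152, Table III (`p = 3`). [Papadopoulos1993]
* O. G. Rizzo, Compositio Math. 136 (2003) 1–23, Table II (p. 4). [Rizzo2003]
-/

open Polynomial IsLocalRing
open IsDiscreteValuationRing hiding maximalIdeal

namespace Literature.NumberTheory.DiophantineGeometry

namespace TateAlgorithm

variable {R : Type*} [CommRing R] [IsDomain R] [IsDiscreteValuationRing R]

omit [IsDomain R] [IsDiscreteValuationRing R] in
/-- `(9 : R) = 3²`, `27 = 3³`, `81 = 3⁴`, `243 = 3⁵` (numeral bookkeeping). [folklore] -/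
private theorem nine_eq : (9 : R) = 3 ^ 2 ∧ (27 : R) = 3 ^ 3 ∧ (81 : R) = 3 ^ 4 ∧
    (243 : R) = 3 ^ 5 := by
  refine ⟨by norm_num, by norm_num, by norm_num, by norm_num⟩

/-- **The row datum of a minimal Weierstrass equation at `p = 3` (Papadopoulos 1993, Table III;
Rizzo 2003, Table II, columns Kod and `(v(c₄), v(c₆), v(Δ))`).**  Let `R` be a DVR with perfect
residue field, `2 ∈ Rˣ`, `3` a uniformiser, and `W` a Weierstrass equation over `R` with `Δ ≠ 0`
such that no change of variables `(1, r, s, t)` over `R` achieves `π ∣ a₁, π² ∣ a₂, π³ ∣ a₃,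
π⁴ ∣ a₄, π⁶ ∣ a₆` (true for a minimal equation).  Then the Kodaira symbol computed by Tate's
algorithm (`kodairaSymbolOfMinimal`, Silverman *ATAEC* IV.9.4 literally) and the invariants
`(ord c₄, ord c₆, ord Δ)` lie on one of the 24 rows of the table: I₀ `(0,0,0)`, `(1,≥3,0)`;
Iₙ `(0,0,n)`; II `(≥2,3,3)`, `(2,4,3)`, `(2,3,4)`, `(≥3,4,5)`; III `(≥2,3,3)`, `(2,≥5,3)`;
IV `(2,3,5)`, `(3,5,6)`, `(≥4,5,7)`; I₀* `(2,3,6)`, `(3,≥6,6)`; Iₙ* `(2,3,6+n)`;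
IV* `(≥4,6,9)`, `(4,7,9)`, `(4,6,10)`, `(≥5,7,11)`; III* `(≥4,6,9)`, `(4,≥8,9)`;
II* `(4,6,11)`, `(5,8,12)`, `(≥6,8,13)` — where on the two pairs of rows shared by II / III and
IV* / III* the intrinsic datum behind Rizzo's special condition is recorded: `c₄ = 3^e(β² − 8B₄)`,
`c₆ = 3^{e'}(−β³ + 12βB₄ − 24B₆)` with `β ∈ Rˣ` and `B₆ ∈ Rˣ` (II, IV*) resp. `3 ∣ B₆`
(III, III*).  Proof: the walk of `addVal_Δ_toNat_le_numComponents_add_four` with the exits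
evaluated by `exitII_values`, …, `exitIIstar_values`, `good_values`, `multiplicative_values`.
[cite: Silverman1994, IV.9.4 and Table 4.1] [cite: Papadopoulos1993, Table III (p = 3)]
[cite: Rizzo2003, Table II (p. 4)] -/
theorem rowDatum_of_minimal [PerfectField (ResidueField R)]
    (h2 : IsUnit (2 : R)) (h3 : Irreducible (3 : R))
    (W : WeierstrassCurve R) (hΔ0 : W.Δ ≠ 0)
    (hmin : ∀ C : WeierstrassCurve.VariableChange R, C.u = 1 →
      uniformizer R ∣ (C • W).a₁ → uniformizer R ^ 2 ∣ (C • W).a₂ →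
      uniformizer R ^ 3 ∣ (C • W).a₃ → uniformizer R ^ 4 ∣ (C • W).a₄ →
      uniformizer R ^ 6 ∣ (C • W).a₆ → False) :
    (W.kodairaSymbolOfMinimal = .I 0 ∧ ¬ (3 : R) ∣ W.Δ ∧
      ((¬ (3 : R) ∣ W.c₄ ∧ ¬ (3 : R) ∣ W.c₆) ∨
        ((addVal R W.c₄).toNat = 1 ∧ (3 : R) ^ 3 ∣ W.c₆))) ∨
    (∃ n, 1 ≤ n ∧ W.kodairaSymbolOfMinimal = .I n ∧ (addVal R W.Δ).toNat = n ∧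
      ¬ (3 : R) ∣ W.c₄ ∧ ¬ (3 : R) ∣ W.c₆) ∨
    (W.kodairaSymbolOfMinimal = .II ∧
      (((addVal R W.Δ).toNat = 3 ∧ (3 : R) ^ 2 ∣ W.c₄ ∧ (addVal R W.c₆).toNat = 3 ∧
          ∃ β B₄ B₆ : R, W.c₄ = 9 * (β ^ 2 - 8 * B₄) ∧
            W.c₆ = 27 * (-β ^ 3 + 12 * β * B₄ - 24 * B₆) ∧ IsUnit β ∧ IsUnit B₄ ∧ IsUnit B₆) ∨
        ((addVal R W.Δ).toNat = 3 ∧ (addVal R W.c₄).toNat = 2 ∧ (addVal R W.c₆).toNat = 4) ∨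
        ((addVal R W.Δ).toNat = 4 ∧ (addVal R W.c₄).toNat = 2 ∧ (addVal R W.c₆).toNat = 3) ∨
        ((addVal R W.Δ).toNat = 5 ∧ (3 : R) ^ 3 ∣ W.c₄ ∧ (addVal R W.c₆).toNat = 4))) ∨
    (W.kodairaSymbolOfMinimal = .III ∧ (addVal R W.Δ).toNat = 3 ∧
      (((3 : R) ^ 2 ∣ W.c₄ ∧ (addVal R W.c₆).toNat = 3 ∧
          ∃ β B₄ B₆ : R, W.c₄ = 9 * (β ^ 2 - 8 * B₄) ∧
            W.c₆ = 27 * (-β ^ 3 + 12 * β * B₄ - 24 * B₆) ∧ IsUnit β ∧ IsUnit B₄ ∧ (3 : R) ∣ B₆) ∨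
        ((addVal R W.c₄).toNat = 2 ∧ (3 : R) ^ 5 ∣ W.c₆))) ∨
    (W.kodairaSymbolOfMinimal = .IV ∧
      (((addVal R W.c₄).toNat = 2 ∧ (addVal R W.c₆).toNat = 3 ∧ (addVal R W.Δ).toNat = 5) ∨
        ((addVal R W.c₄).toNat = 3 ∧ (addVal R W.c₆).toNat = 5 ∧ (addVal R W.Δ).toNat = 6) ∨
        ((3 : R) ^ 4 ∣ W.c₄ ∧ (addVal R W.c₆).toNat = 5 ∧ (addVal R W.Δ).toNat = 7))) ∨
    (W.kodairaSymbolOfMinimal = .Istar 0 ∧ (addVal R W.Δ).toNat = 6 ∧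
      (((addVal R W.c₄).toNat = 2 ∧ (addVal R W.c₆).toNat = 3) ∨
        ((addVal R W.c₄).toNat = 3 ∧ (3 : R) ^ 6 ∣ W.c₆))) ∨
    (∃ n, 1 ≤ n ∧ W.kodairaSymbolOfMinimal = .Istar n ∧ n + 6 = (addVal R W.Δ).toNat ∧
      (addVal R W.c₄).toNat = 2 ∧ (addVal R W.c₆).toNat = 3) ∨
    (W.kodairaSymbolOfMinimal = .IVstar ∧
      (((3 : R) ^ 4 ∣ W.c₄ ∧ (addVal R W.c₆).toNat = 6 ∧ (addVal R W.Δ).toNat = 9 ∧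
          ∃ B₂ B₄ B₆ : R, W.c₄ = 3 ^ 4 * (B₂ ^ 2 - 8 * B₄) ∧
            W.c₆ = 3 ^ 6 * (-B₂ ^ 3 + 12 * B₂ * B₄ - 24 * B₆) ∧
            IsUnit B₂ ∧ IsUnit B₄ ∧ IsUnit B₆) ∨
        ((addVal R W.c₄).toNat = 4 ∧ (addVal R W.c₆).toNat = 7 ∧ (addVal R W.Δ).toNat = 9) ∨
        ((addVal R W.c₄).toNat = 4 ∧ (addVal R W.c₆).toNat = 6 ∧ (addVal R W.Δ).toNat = 10) ∨
        ((3 : R) ^ 5 ∣ W.c₄ ∧ (addVal R W.c₆).toNat = 7 ∧ (addVal R W.Δ).toNat = 11))) ∨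
    (W.kodairaSymbolOfMinimal = .IIIstar ∧ (addVal R W.Δ).toNat = 9 ∧
      (((3 : R) ^ 4 ∣ W.c₄ ∧ (addVal R W.c₆).toNat = 6 ∧
          ∃ B₂ B₄ B₆ : R, W.c₄ = 3 ^ 4 * (B₂ ^ 2 - 8 * B₄) ∧
            W.c₆ = 3 ^ 6 * (-B₂ ^ 3 + 12 * B₂ * B₄ - 24 * B₆) ∧
            IsUnit B₂ ∧ IsUnit B₄ ∧ (3 : R) ∣ B₆) ∨
        ((addVal R W.c₄).toNat = 4 ∧ (3 : R) ^ 8 ∣ W.c₆))) ∨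
    (W.kodairaSymbolOfMinimal = .IIstar ∧
      (((addVal R W.c₄).toNat = 4 ∧ (addVal R W.c₆).toNat = 6 ∧ (addVal R W.Δ).toNat = 11) ∨
        ((addVal R W.c₄).toNat = 5 ∧ (addVal R W.c₆).toNat = 8 ∧ (addVal R W.Δ).toNat = 12) ∨
        ((3 : R) ^ 6 ∣ W.c₄ ∧ (addVal R W.c₆).toNat = 8 ∧ (addVal R W.Δ).toNat = 13))) := by
  classical
  have hϖ : Irreducible (uniformizer R) := irreducible_uniformizer
  obtain ⟨h9, h27, h81, h243⟩ := nine_eq (R := R)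
  -- Step 1: good reduction
  by_cases hΔ : W.Δ ∈ maximalIdeal R
  swap
  · have hI : W.kodairaSymbolOfMinimal = .I 0 := by
      unfold WeierstrassCurve.kodairaSymbolOfMinimal
      dsimp only
      rw [if_pos hΔ]
    have hΔ' : ¬ (3 : R) ∣ W.Δ := fun h => hΔ ((mem_maximalIdeal_iff_dvd_of_irreducible h3 _).mpr h)
    exact Or.inl ⟨hI, hΔ', good_values h2 h3 W hΔ'⟩
  have hΔ3 : (3 : R) ∣ W.Δ := (mem_maximalIdeal_iff_dvd_of_irreducible h3 _).mp hΔ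
  -- Step 2: multiplicative reduction
  by_cases hc₄ : W.c₄ ∈ maximalIdeal R
  swap
  · have hn : (addVal R W.Δ).toNat ≠ 0 := by
      intro h0
      rw [ENat.toNat_eq_zero] at h0
      rcases h0 with h0 | htop
      · have h1 : ((1 : ℕ) : ℕ∞) ≤ addVal R W.Δ := by
          rw [← pow_dvd_iff_le_addVal, pow_one]; exact mem_maximalIdeal_iff_dvd.mp hΔ
        rw [h0, Nat.cast_one] at h1
        exact one_ne_zero (nonpos_iff_eq_zero.mp h1)
      · exact hΔ0 (addVal_eq_top_iff.mp htop)
    have hI : W.kodairaSymbolOfMinimal = .I (addVal R W.Δ).toNat :=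
      (W.kodairaSymbolOfMinimal_eq_I_iff hn).mpr ⟨hΔ, hc₄, rfl⟩
    have hc₄' : ¬ (3 : R) ∣ W.c₄ := fun h => hc₄ ((mem_maximalIdeal_iff_dvd_of_irreducible h3 _).mpr h)
    exact Or.inr (Or.inl ⟨_, Nat.one_le_iff_ne_zero.mpr hn, hI, rfl, hc₄',
      multiplicative_values h3 W hΔ3 hc₄'⟩)
  -- additive reduction: walk Steps 3–10 on the normalised models
  have hc₄3 : (3 : R) ∣ W.c₄ := (mem_maximalIdeal_iff_dvd_of_irreducible h3 _).mp hc₄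
  generalize hS : W.kodairaSymbolOfMinimal = S
  have hex2 := exists_variableChange_step2_of_perfectField W hΔ
  have hN2 : normalizeStep2 W = hex2.choose • W := dif_pos hex2
  obtain ⟨hu₂, hA₃, hA₄, hA₆⟩ := hex2.choose_spec
  unfold WeierstrassCurve.kodairaSymbolOfMinimal at hS
  dsimp only at hS
  rw [if_neg (not_not.mpr hΔ), hN2] at hS
  set W₂ := hex2.choose • W with hW₂def
  have hΔ₂ : W₂.Δ = W.Δ := Δ_smul_of_u_eq_one hu₂ W
  have hc₄₂ : W₂.c₄ = W.c₄ := c₄_smul_of_u_eq_one hu₂ W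
  have hc₆₂ : W₂.c₆ = W.c₆ := c₆_smul_of_u_eq_one hu₂ W
  have ha₃ : (3 : R) ∣ W₂.a₃ := (mem_maximalIdeal_iff_dvd_of_irreducible h3 _).mp hA₃
  have ha₄ : (3 : R) ∣ W₂.a₄ := (mem_maximalIdeal_iff_dvd_of_irreducible h3 _).mp hA₄
  have ha₆ : (3 : R) ∣ W₂.a₆ := (mem_maximalIdeal_iff_dvd_of_irreducible h3 _).mp hA₆
  have hb₂ : (3 : R) ∣ W₂.b₂ := by
    have hb₄ : (3 : R) ∣ W₂.b₄ := by
      simp only [WeierstrassCurve.b₄]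
      exact dvd_add (dvd_mul_of_dvd_right ha₄ _) (dvd_mul_of_dvd_right ha₃ _)
    have : (3 : R) ∣ W₂.b₂ ^ 2 := by
      have e : W₂.b₂ ^ 2 = W₂.c₄ + 24 * W₂.b₄ := by
        simp only [WeierstrassCurve.c₄]; ring
      rw [e, hc₄₂]
      exact dvd_add hc₄3 (dvd_mul_of_dvd_right hb₄ _)
    exact h3.prime.dvd_of_dvd_pow this
  have hb₂' : W₂.b₂ ∈ maximalIdeal R := (mem_maximalIdeal_iff_dvd_of_irreducible h3 _).mpr hb₂
  rw [if_neg (not_not.mpr hb₂')] at hS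
  -- Step 3: II
  by_cases h3t : W₂.a₆ ∈ maximalIdeal R ^ 2
  swap
  · rw [if_pos h3t] at hS
    subst hS
    have h6 : ¬ (3 : R) ^ 2 ∣ W₂.a₆ := fun h => h3t ((mem_maximalIdeal_pow_iff_dvd_of_irreducible h3 _ _).mpr h)
    obtain ⟨β, B₄, B₆, hβ, hB₄e, hB₆e, hB₆, hcases⟩ := exitII_values h2 h3 W₂ ha₃ ha₄ ha₆ hb₂ h6
    have hc₄W : W.c₄ = 9 * (β ^ 2 - 8 * B₄) := by rw [← hc₄₂]; exact c₄_of_b_three W₂ hβ hB₄e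
    have hc₆W : W.c₆ = 27 * (-β ^ 3 + 12 * β * B₄ - 24 * B₆) := by
      rw [← hc₆₂]; exact c₆_of_b_three W₂ hβ hB₄e hB₆e
    rw [hΔ₂, hc₄₂, hc₆₂, h9, h27] at hcases
    refine Or.inr (Or.inr (Or.inl ⟨rfl, ?_⟩))
    rcases hcases with ⟨hβu, hB₄u, h4, h6v, hΔv⟩ | ⟨-, -, h4, h6v, hΔv⟩ | ⟨-, -, h4, h6v, hΔv⟩ |
      ⟨-, -, h4, h6v, hΔv⟩
    · exact Or.inl ⟨hΔv, h4, h6v, β, B₄, B₆, hc₄W, hc₆W, hβu, hB₄u, hB₆⟩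
    · exact Or.inr (Or.inl ⟨hΔv, h4, h6v⟩)
    · exact Or.inr (Or.inr (Or.inl ⟨hΔv, h4, h6v⟩))
    · exact Or.inr (Or.inr (Or.inr ⟨hΔv, h4, h6v⟩))
  rw [if_neg (not_not.mpr h3t)] at hS
  have ha₆' : (3 : R) ^ 2 ∣ W₂.a₆ := (mem_maximalIdeal_pow_iff_dvd_of_irreducible h3 _ _).mp h3t
  -- Step 4: III
  by_cases h4t : W₂.b₈ ∈ maximalIdeal R ^ 3
  swap
  · rw [if_pos h4t] at hS
    subst hS
    have h8 : ¬ (3 : R) ^ 3 ∣ W₂.b₈ := fun h => h4t ((mem_maximalIdeal_pow_iff_dvd_of_irreducible h3 _ _).mpr h)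
    obtain ⟨β, B₄, B₆, hβ, hB₄e, hB₆e, hB₄, hB₆, hΔv, hcases⟩ :=
      exitIII_values h2 h3 W₂ ha₃ ha₄ ha₆' hb₂ h8
    have hc₄W : W.c₄ = 9 * (β ^ 2 - 8 * B₄) := by rw [← hc₄₂]; exact c₄_of_b_three W₂ hβ hB₄e
    have hc₆W : W.c₆ = 27 * (-β ^ 3 + 12 * β * B₄ - 24 * B₆) := by
      rw [← hc₆₂]; exact c₆_of_b_three W₂ hβ hB₄e hB₆e
    rw [hΔ₂] at hΔv
    rw [hc₄₂, hc₆₂, h9, h243] at hcases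
    refine Or.inr (Or.inr (Or.inr (Or.inl ⟨rfl, hΔv, ?_⟩)))
    rcases hcases with ⟨hβu, h4, h6v⟩ | ⟨-, h4, h6v⟩
    · exact Or.inl ⟨h4, h6v, β, B₄, B₆, hc₄W, hc₆W, hβu, hB₄, hB₆⟩
    · exact Or.inr ⟨h4, h6v⟩
  rw [if_neg (not_not.mpr h4t)] at hS
  have hb₈ : (3 : R) ^ 3 ∣ W₂.b₈ := (mem_maximalIdeal_pow_iff_dvd_of_irreducible h3 _ _).mp h4t
  -- Step 5: IV
  by_cases h5t : W₂.b₆ ∈ maximalIdeal R ^ 3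
  swap
  · rw [if_pos h5t] at hS
    subst hS
    have h6 : ¬ (3 : R) ^ 3 ∣ W₂.b₆ := fun h => h5t ((mem_maximalIdeal_pow_iff_dvd_of_irreducible h3 _ _).mpr h)
    obtain ⟨β, B₄, B₆, -, -, -, -, hcases⟩ := exitIV_values h2 h3 W₂ ha₃ ha₄ ha₆' hb₂ hb₈ h6
    rw [hΔ₂, hc₄₂, hc₆₂, h81] at hcases
    refine Or.inr (Or.inr (Or.inr (Or.inr (Or.inl ⟨rfl, ?_⟩))))
    rcases hcases with ⟨-, h4, h6v, hΔv⟩ | ⟨-, -, h4, h6v, hΔv⟩ | ⟨-, -, h4, h6v, hΔv⟩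
    · exact Or.inl ⟨h4, h6v, hΔv⟩
    · exact Or.inr (Or.inl ⟨h4, h6v, hΔv⟩)
    · exact Or.inr (Or.inr ⟨h4, h6v, hΔv⟩)
  rw [if_neg (not_not.mpr h5t)] at hS
  -- Step 6 translation
  have hex6 := exists_variableChange_step6_of_perfectField (V := W₂) hb₂' hA₃ hA₄ h3t h5t h4t
  have hN6 : normalizeStep6 W₂ = hex6.choose • W₂ := dif_pos hex6
  obtain ⟨hu₆, hB₁, hB₂, hB₃, hB₄, hB₆⟩ := hex6.choose_spec
  rw [hN6] at hS
  set W₆ := hex6.choose • W₂ with hW₆def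
  have hΔ₆ : W₆.Δ = W.Δ := (Δ_smul_of_u_eq_one hu₆ W₂).trans hΔ₂
  have hc₄₆ : W₆.c₄ = W.c₄ := (c₄_smul_of_u_eq_one hu₆ W₂).trans hc₄₂
  have hc₆₆ : W₆.c₆ = W.c₆ := (c₆_smul_of_u_eq_one hu₆ W₂).trans hc₆₂
  have hΔ₆0 : W₆.Δ ≠ 0 := by rwa [hΔ₆]
  have h67 := exitIstar_values h2 h3 W₆ hB₁ hB₂ hB₃ hB₄ hB₆
  -- Step 6: I₀*
  by_cases h6t : distinctRootCount (cubicStep6 W₆) = 3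
  · rw [if_pos h6t] at hS
    subst hS
    obtain ⟨hΔv, hcases⟩ := h67.1 h6t
    rw [hΔ₆] at hΔv
    rw [hc₄₆, hc₆₆] at hcases
    exact Or.inr (Or.inr (Or.inr (Or.inr (Or.inr (Or.inl ⟨rfl, hΔv, hcases⟩)))))
  rw [if_neg h6t] at hS
  -- Step 7: Iₙ*, `n = ord Δ − 6 ≥ 1`
  by_cases h7t : distinctRootCount (cubicStep6 W₆) = 2
  · rw [if_pos h7t] at hS
    subst hS
    obtain ⟨hΔ7, hc₄u, h4, h6v⟩ := h67.2 h7t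
    have hex7 := exists_variableChange_step7_of_perfectField hB₁ hB₂ hB₃ hB₄ hB₆ h7t
    have hn := istarIndex_add_six h2 W₆ hΔ₆0 hΔ7 hc₄u hex7
    have h7le : 7 ≤ (addVal R W₆.Δ).toNat := le_addVal_toNat_of_pow_dvd hϖ hΔ₆0 hΔ7
    rw [hΔ₆] at hn h7le
    rw [hc₄₆] at h4
    rw [hc₆₆] at h6v
    exact Or.inr (Or.inr (Or.inr (Or.inr (Or.inr (Or.inr (Or.inl
      ⟨_, by omega, rfl, hn, h4, h6v⟩))))))
  rw [if_neg h7t] at hS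
  -- Step 8 translation
  have hex8 := exists_variableChange_step8_of_perfectField hB₁ hB₂ hB₃ hB₄ hB₆ h6t h7t
  have hN8 : normalizeStep8 W₆ = hex8.choose • W₆ := dif_pos hex8
  obtain ⟨hu₈, hD₁, hD₂, hD₃, hD₄, hD₆⟩ := hex8.choose_spec
  rw [hN8] at hS
  set W₈ := hex8.choose • W₆ with hW₈def
  have hΔ₈ : W₈.Δ = W.Δ := (Δ_smul_of_u_eq_one hu₈ W₆).trans hΔ₆
  have hc₄₈ : W₈.c₄ = W.c₄ := (c₄_smul_of_u_eq_one hu₈ W₆).trans hc₄₆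
  have hc₆₈ : W₈.c₆ = W.c₆ := (c₆_smul_of_u_eq_one hu₈ W₆).trans hc₆₆
  -- Step 8: IV*
  by_cases h8t : distinctRootCount (quadraticStep8 W₈) = 2
  · rw [if_pos h8t] at hS
    subst hS
    obtain ⟨B₂, B₄, B₆, hb₂e, hb₄e, hb₆e, hB₆u, hcases⟩ :=
      exitIVstar_values h2 h3 W₈ hD₁ hD₂ hD₃ hD₄ hD₆ h8t
    have hc₄W : W.c₄ = 3 ^ 4 * (B₂ ^ 2 - 8 * B₄) := by rw [← hc₄₈]; exact c₄_of_b_nine W₈ hb₂e hb₄e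
    have hc₆W : W.c₆ = 3 ^ 6 * (-B₂ ^ 3 + 12 * B₂ * B₄ - 24 * B₆) := by
      rw [← hc₆₈]; exact c₆_of_b_nine W₈ hb₂e hb₄e hb₆e
    rw [hΔ₈, hc₄₈, hc₆₈] at hcases
    refine Or.inr (Or.inr (Or.inr (Or.inr (Or.inr (Or.inr (Or.inr (Or.inl ⟨rfl, ?_⟩)))))))
    rcases hcases with ⟨hB₂u, hB₄u, h4, h6v, hΔv⟩ | ⟨-, -, h4, h6v, hΔv⟩ | ⟨-, -, h4, h6v, hΔv⟩ |
      ⟨-, -, h4, h6v, hΔv⟩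
    · exact Or.inl ⟨h4, h6v, hΔv, B₂, B₄, B₆, hc₄W, hc₆W, hB₂u, hB₄u, hB₆u⟩
    · exact Or.inr (Or.inl ⟨h4, h6v, hΔv⟩)
    · exact Or.inr (Or.inr (Or.inl ⟨h4, h6v, hΔv⟩))
    · exact Or.inr (Or.inr (Or.inr ⟨h4, h6v, hΔv⟩))
  rw [if_neg h8t] at hS
  -- Step 9 translation
  have hex9 := exists_variableChange_step9_of_perfectField hD₁ hD₂ hD₃ hD₄ hD₆ h8t
  have hN9 : normalizeStep9 W₈ = hex9.choose • W₈ := dif_pos hex9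
  obtain ⟨hu₉, hE₁, hE₂, hE₃, hE₄, hE₆⟩ := hex9.choose_spec
  rw [hN9] at hS
  set W₉ := hex9.choose • W₈ with hW₉def
  have hΔ₉ : W₉.Δ = W.Δ := (Δ_smul_of_u_eq_one hu₉ W₈).trans hΔ₈
  have hc₄₉ : W₉.c₄ = W.c₄ := (c₄_smul_of_u_eq_one hu₉ W₈).trans hc₄₈
  have hc₆₉ : W₉.c₆ = W.c₆ := (c₆_smul_of_u_eq_one hu₉ W₈).trans hc₆₈
  -- Step 9: III*
  by_cases h9t : W₉.a₄ ∈ maximalIdeal R ^ 4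
  swap
  · rw [if_pos h9t] at hS
    subst hS
    obtain ⟨B₂, B₄, B₆, hb₂e, hb₄e, hb₆e, hB₄u, hB₆d, hΔv, hcases⟩ :=
      exitIIIstar_values h2 h3 W₉ hE₁ hE₂ hE₃ hE₄ hE₆ h9t
    have hc₄W : W.c₄ = 3 ^ 4 * (B₂ ^ 2 - 8 * B₄) := by rw [← hc₄₉]; exact c₄_of_b_nine W₉ hb₂e hb₄e
    have hc₆W : W.c₆ = 3 ^ 6 * (-B₂ ^ 3 + 12 * B₂ * B₄ - 24 * B₆) := by
      rw [← hc₆₉]; exact c₆_of_b_nine W₉ hb₂e hb₄e hb₆e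
    rw [hΔ₉] at hΔv
    rw [hc₄₉, hc₆₉] at hcases
    refine Or.inr (Or.inr (Or.inr (Or.inr (Or.inr (Or.inr (Or.inr (Or.inr (Or.inl
      ⟨rfl, hΔv, ?_⟩))))))))
    rcases hcases with ⟨hB₂u, h4, h6v⟩ | ⟨-, h4, h6v⟩
    · exact Or.inl ⟨h4, h6v, B₂, B₄, B₆, hc₄W, hc₆W, hB₂u, hB₄u, hB₆d⟩
    · exact Or.inr ⟨h4, h6v⟩
  rw [if_neg (not_not.mpr h9t)] at hS
  -- Step 10: II*
  by_cases h10t : W₉.a₆ ∈ maximalIdeal R ^ 6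
  swap
  · rw [if_pos h10t] at hS
    subst hS
    obtain ⟨B₂, B₄, B₆, -, -, -, -, hcases⟩ :=
      exitIIstar_values h2 h3 W₉ hE₁ hE₂ hE₃ h9t hE₆ h10t
    rw [hΔ₉, hc₄₉, hc₆₉] at hcases
    refine Or.inr (Or.inr (Or.inr (Or.inr (Or.inr (Or.inr (Or.inr (Or.inr (Or.inr
      ⟨rfl, ?_⟩))))))))
    rcases hcases with ⟨-, h4, h6v, hΔv⟩ | ⟨-, -, h4, h6v, hΔv⟩ | ⟨-, -, h4, h6v, hΔv⟩
    · exact Or.inl ⟨h4, h6v, hΔv⟩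
    · exact Or.inr (Or.inl ⟨h4, h6v, hΔv⟩)
    · exact Or.inr (Or.inr ⟨h4, h6v, hΔv⟩)
  -- Step 11 cannot be reached
  exfalso
  have h9a₁ := (mem_maximalIdeal_iff_dvd_of_irreducible hϖ _).mp hE₁
  have h9a₂ := (mem_maximalIdeal_pow_iff_dvd_of_irreducible hϖ _ _).mp hE₂
  have h9a₃ := (mem_maximalIdeal_pow_iff_dvd_of_irreducible hϖ _ _).mp hE₃
  have h9a₄ := (mem_maximalIdeal_pow_iff_dvd_of_irreducible hϖ _ _).mp h9t
  have h9a₆ := (mem_maximalIdeal_pow_iff_dvd_of_irreducible hϖ _ _).mp h10t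
  have hW₉ : W₉ = (hex9.choose * hex8.choose * hex6.choose * hex2.choose) • W := by
    simp only [mul_smul]; rfl
  have hu : (hex9.choose * hex8.choose * hex6.choose * hex2.choose).u = 1 := by
    simp only [WeierstrassCurve.VariableChange.mul_def, hu₂, hu₆, hu₈, hu₉, mul_one]
  refine hmin _ hu ?_ ?_ ?_ ?_ ?_
  · rw [← hW₉]; exact h9a₁
  · rw [← hW₉]; exact h9a₂
  · rw [← hW₉]; exact h9a₃
  · rw [← hW₉]; exact h9a₄
  · rw [← hW₉]; exact h9a₆

end TateAlgorithm

end Literature.NumberTheory.DiophantineGeometry
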